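/- Copyright: the b2b-balaban cell (near-miss cell 7), T⁴-continuum fan-out; row NE7b ROUND-2 swarm, seat
t4-ne7b-formalise-leaf-06 (gen 4) (road W-RP-VAR, row W4 file 3 «THE PER-CUTOFF EVENT READING», twin of file 2 with
cutoff-dependent carriers; INTENT journal l.14072).  Released under the licence of the surrounding project. -/
import Summits.QuantumFields.BalabanUV.T4Continuum.Support.HistoryChessboardEvents
import Summits.QuantumFields.BalabanUV.T4Continuum.Support.HistoryRPExtension

/-!
# Road W-RP-VAR, row W4 file 3: THE PER-CUTOFF EVENT READING — one cutoff, its own carrier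

Summits-side support leaf of the T⁴-continuum cell (rung (B)+1 on a FINITE torus only; NOT infinite volume, NOT the
mass gap, NOT the Clay statement; NOT a proof of the spine estimate NE7b).  Row NE7b, road **W-RP-VAR** (owner's
ruling R-OWNER-23-2: a LIVE SECONDARY road beside the COUNT road of record), row **W4**, file 3 — a twin of file 2
(`HistoryChessboardEvents`, same lineage) in which the carrier of the state may DEPEND ON THE CUTOFF.  [folklore]
measure-theoretic bookkeeping (Mathlib) over the cell's OWN records, consuming BY NAME file 1 (`ChessboardReading` ⇒
`HybridNE7`), file 2 (its carrier-free lemmas and `EventReading`), row W5 (`chessboardFields_of_isReflectionPositiveBdd`),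
row W1 (`dressing_of_linear`), row W3b (`exists_eq_comp_of_measurable_comap`) and the tree's definition
`LatticeRP.IsReflectionPositiveBdd`.  Nothing is quoted from Bałaban's papers, nothing printed is asserted, no citation
tag of the series, no `Prop`-valued FACT minted (trigger c1), no `def`: the one `structure … : Prop` (`CutoffReading`)
is a HYPOTHESIS SHAPE consumed only as a binder (definition lane).

WHY (a located artefact of file 2, not a change of content).  File 2's `EventReading` takes ONE measurable carrier `Ω`
and `μ : ℕ → Measure Ω` for ALL cutoffs; but the state read at cutoff `K` lives on a carrier that GROWS with `K` (its
level-0 marginal is Wilson's measure on the fine torus `GaugeConfig d L_K G`, `L_K → ∞`, where rows W3b∕W3c produce the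
RP-package; the extended state adds the block-bond variables of the levels `≤ K`), so an instance of file 2 must embed
every cutoff into one product carrier.  Here the hypothesis is stated PER CUTOFF on the cutoff's OWN carrier (§1), file
2's derivations are re-run per cutoff (§2), a FAMILY of per-cutoff readings on carriers `Ω K` gives file 1's
`ChessboardReading` and the road's END (§3 **`hybridNE7_of_cutoffReadings`**), file 2 is the constant-carrier case (§4
`EventReading.cutoffReading`), and §5 is the one abstract lemma the product-carrier route needs instead — the PULL-BACK
of an RP-package along a measure-preserving, reflection-equivariant factor map (**`isReflectionPositiveBdd_pullback`**,
`rpPackage_pullback`; also how a level-0 package enters a product extension along `Prod.fst`).  §6 sanity: §1 is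
INHABITED; §3 type-checks on a carrier family growing with `K`.

HONEST SCOPE (R-OWNER-23-2 (iii), verbatim for this §W row): W-RP-VAR is a producer of NE7b's socket for the
CENTRED-AVERAGING VARIANT of the construction, NOT for Bałaban's printed corner prescription (for which reflection
positivity of the extended measure FAILS, (11c)); the road discharges NE7b only modulo (VAR) + (U1) + (G2) + (EXT)∕(RP-ext)
DISPLAYED — here: the fields of `CutoffReading`; NO field is discharged by this file ((RP-ext) has the by-name producers
W3b∕W3c upstream) —; the count 0∕9 is unchanged; nothing of H3 ∕ (B) ∕ BetaPertH is discharged; no exit ∕ socket ∕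
`HistoryConstants` file is touched (c3); no constant specialised (c2∕c6).  NE7b NOT proved; spine 0∕9.  HONEST
DEPENDENCY (cell): continuum YM on T⁴ ⇐ BetaPertH ∧ nine spine estimates (0/9 proved); BetaPertH ⇐ (D1) ∧ (D4) ∧
CAP+tail; G-an2-4 gates asym, D1 and NE2/3/4.  This file changes none of it.
-/

open Finset MeasureTheory Literature.Barriers.CriticalPhenomena.NonGibbs Literature.Probability.LatticeModels
open Literature.MathematicalPhysics.QuantumFieldTheory.Balaban1983to89
open T4IndicatorShell T4MatchingAssembly T4MatchingClosure
open Literature.MathematicalPhysics.QuantumFieldTheory.LatticeRP (IsReflectionPositiveBdd)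
open Summit.QuantumFields.BalabanUV.T4Continuum HistoryChessboardAssembly HistoryChessboardEvents

namespace Summit.QuantumFields.BalabanUV.T4Continuum.HistoryChessboardEventsCutoff

noncomputable section
/-! ## §1 The event reading of ONE run AT ONE CUTOFF, on the cutoff's own carrier -/
section Reading
variable {Ω ι Λ : Type*} [MeasurableSpace Ω] {d N : ℕ}

/-- **THE EVENT READING OF ONE RUN AT ONE CUTOFF** (road W-RP-VAR, row W4 file 3): file 2's `EventReading`
clauses AT ONE CUTOFF on THIS cutoff's carrier `(Ω, m)` — a PROBABILITY measure `μ` (READING, not instantiated: the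
normalised extended state of the run at this cutoff for the CENTRED prescription — (VAR) is this sentence), undressed
partition function `Z`, terms `T` with dressed weights `A t τ` and bad class `Bad`, term events `ev τ`, a source
observable `obs` bounded by `ob`, cell events `E l c` of the patterns `l ∈ P` on the block torus `BlockIdx d N`, per
block hyperplane `(i, k)` a reflection `θ i k` and a positive-half σ-algebra `mP i k`, the per-cell rate `r`.  Clauses:
bookkeeping (`prob` … `ob_nonneg`); `repr` = (EXT)+(DRESS); `ev_cover`, `bad_disj`, `bad_sub` = (EXT)∘(LOC);
`mP_le`, `θ_meas`, `θ_pres`, `θ_invol`, `rp` = (RP-ext)+(VAR), the RP-package in the tree's bounded form (by-name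
producers: rows W3b∕W3c); `loc` = (LOC); `sym` = (R-sym); `univ_le`, `r_nonneg` = (U1)+(G2) in ratio currency.
A hypothesis SHAPE; NOTHING of Bałaban's is asserted; no citation tag (nothing printed is stated). [folklore] -/
structure CutoffReading (d N : ℕ) [NeZero N] (P : Finset Λ) (T : Finset ι) (A : ℝ → ι → ℝ) (Bad : Finset ι)
    (μ : Measure Ω) (Z : ℝ) (ev : ι → Set Ω) (obs : Ω → ℝ) (ob : ℝ) (E : Λ → BlockIdx d N → Set Ω)
    (θ : Fin d → ZMod N → Ω → Ω) (mP : Fin d → ZMod N → MeasurableSpace Ω) (r : ℝ) : Prop where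
  /-- the state is a probability measure (the NORMALISED extended state at this cutoff) -/
  prob : IsProbabilityMeasure μ
  /-- the undressed partition function is positive -/
  Z_pos : 0 < Z
  /-- the bad class consists of terms -/
  bad_subset : Bad ⊆ T
  /-- term events are measurable -/
  ev_meas : ∀ τ ∈ T, MeasurableSet (ev τ)
  /-- cell events are measurable -/
  E_meas : ∀ l ∈ P, ∀ c, MeasurableSet (E l c)
  /-- the source observable is measurable … -/
  obs_meas : Measurable obs
  /-- … and bounded by `ob` -/
  obs_bdd : ∀ ω, |obs ω| ≤ ob
  /-- the bound is nonnegative (automatic on a nonempty carrier; recorded for the empty one) -/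
  ob_nonneg : 0 ≤ ob
  /-- (EXT)+(DRESS): the dressed weight of a term is the source-dressed mass of its event -/
  repr : ∀ (t : ℝ), ∀ τ ∈ T, A t τ = Z * ∫ ω in ev τ, Real.exp (t * obs ω) ∂μ
  /-- the term events exhaust the state (partition of unity) -/
  ev_cover : Set.univ ⊆ ⋃ τ ∈ T, ev τ
  /-- (EXT): bad events are pairwise disjoint -/
  bad_disj : (↑Bad : Set ι).PairwiseDisjoint ev
  /-- (EXT)∘(LOC): every bad event lies inside a single-cell event of some pattern -/
  bad_sub : ∀ τ ∈ Bad, ev τ ⊆ ⋃ l ∈ P, ⋃ c : BlockIdx d N, E l c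
  /-- the positive-half σ-algebras are sub-σ-algebras of the carrier's -/
  mP_le : ∀ (i : Fin d) (k : ZMod N), mP i k ≤ ‹MeasurableSpace Ω›
  /-- the reflections are measurable … -/
  θ_meas : ∀ (i : Fin d) (k : ZMod N), Measurable (θ i k)
  /-- … preserve the state … -/
  θ_pres : ∀ (i : Fin d) (k : ZMod N), MeasurePreserving (θ i k) μ μ
  /-- … and are involutions -/
  θ_invol : ∀ (i : Fin d) (k : ZMod N), θ i k ∘ θ i k = id
  /-- (RP-ext)+(VAR): the state is reflection positive across every block hyperplane (tree's bounded form) -/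
  rp : ∀ (i : Fin d) (k : ZMod N), IsReflectionPositiveBdd μ (mP i k) (θ i k)
  /-- (LOC): the cell events of the positive half are positive-half measurable -/
  loc : ∀ l ∈ P, ∀ (i : Fin d) (k : ZMod N), ∀ c ∈ halfPlus N i k, MeasurableSet[mP i k] (E l c)
  /-- (R-sym): the cell events are reflection-related -/
  sym : ∀ l ∈ P, ∀ (i : Fin d) (k : ZMod N) (c : BlockIdx d N), θ i k ⁻¹' E l c = E l (cellReflect i k c)
  /-- (U1)+(G2), ratio currency: the universally forced pattern has probability `≤ r^(N^d)` -/
  univ_le : ∀ l ∈ P, μ.real (⋂ c ∈ (Finset.univ : Finset (BlockIdx d N)), E l c) ≤ r ^ (N ^ d)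
  /-- the per-cell rate is nonnegative -/
  r_nonneg : 0 ≤ r

/-! ## §2 The derivations at one cutoff -/

variable [NeZero N] {P : Finset Λ} {T : Finset ι} {A : ℝ → ι → ℝ} {Bad : Finset ι} {μ : Measure Ω} {Z : ℝ}
  {ev : ι → Set Ω} {obs : Ω → ℝ} {ob : ℝ} {E : Λ → BlockIdx d N → Set Ω} {θ : Fin d → ZMod N → Ω → Ω}
  {mP : Fin d → ZMod N → MeasurableSpace Ω} {r : ℝ}

/-- **THE UNDRESSED WEIGHT IS THE MASS OF THE EVENT**: `A 0 τ = Z · μ(ev τ)`. [folklore] -/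
theorem CutoffReading.weight_zero_eq (H : CutoffReading d N P T A Bad μ Z ev obs ob E θ mP r) {τ : ι}
    (hτ : τ ∈ T) : A 0 τ = Z * μ.real (ev τ) := by
  rw [H.repr 0 τ hτ]
  simp only [zero_mul, Real.exp_zero, setIntegral_const, smul_eq_mul, mul_one]

/-- Undressed weights are nonnegative. [folklore] -/
theorem CutoffReading.weight_zero_nonneg (H : CutoffReading d N P T A Bad μ Z ev obs ob E θ mP r) {τ : ι}
    (hτ : τ ∈ T) : 0 ≤ A 0 τ := by
  rw [H.weight_zero_eq hτ]
  exact mul_nonneg H.Z_pos.le measureReal_nonneg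

/-- **(DRESS) DERIVED** at this cutoff: on the source window `|t| ≤ l₀`, W1's two inequalities with `m = ob·l₀`
(`HistoryChessboardDressing.dressing_of_linear`, file 2's `setIntegral_exp_bounds`). [folklore] -/
theorem CutoffReading.dressing (H : CutoffReading d N P T A Bad μ Z ev obs ob E θ mP r) {l₀ : ℝ} :
    ∀ t, |t| ≤ l₀ → ∀ τ ∈ T, Real.exp (-(ob * l₀)) * A 0 τ ≤ A t τ ∧ A t τ ≤ Real.exp (ob * l₀) * A 0 τ := by
  intro t ht τ hτ
  haveI := H.prob
  have hZ := H.Z_pos.le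
  have hlin : ∀ t' : ℝ, Real.exp (-(ob * |t'|)) * A 0 τ ≤ A t' τ ∧ A t' τ ≤ Real.exp (ob * |t'|) * A 0 τ := by
    intro t'
    have hb := setIntegral_exp_bounds μ H.obs_meas H.obs_bdd (H.ev_meas τ hτ) t'
    rw [H.repr t' τ hτ, H.weight_zero_eq hτ]
    exact ⟨by linarith [mul_le_mul_of_nonneg_left hb.1 hZ], by linarith [mul_le_mul_of_nonneg_left hb.2 hZ]⟩
  exact HistoryChessboardDressing.dressing_of_linear (A := fun t' => A t' τ) (H.weight_zero_nonneg hτ) H.ob_nonneg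
    hlin ht

/-- **(EXT)∘(LOC) DERIVED, probability currency**: the bad events' total probability is at most the total single-cell
probability over patterns and cells. [folklore] -/
theorem CutoffReading.sum_bad_le_cells (H : CutoffReading d N P T A Bad μ Z ev obs ob E θ mP r) :
    ∑ τ ∈ Bad, μ.real (ev τ) ≤ ∑ l ∈ P, ∑ c : BlockIdx d N, μ.real (E l c) := by
  haveI := H.prob
  have hBT := H.bad_subset
  have hU : ⋃ τ ∈ Bad, ev τ ⊆ ⋃ l ∈ P, ⋃ c ∈ (Finset.univ : Finset (BlockIdx d N)), E l c := by
    intro ω hω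
    obtain ⟨τ, hτ, hωτ⟩ := Set.mem_iUnion₂.1 hω
    have h := H.bad_sub τ hτ hωτ
    simp only [Set.mem_iUnion, Finset.mem_univ, Set.iUnion_true] at h ⊢
    exact h
  calc ∑ τ ∈ Bad, μ.real (ev τ) = μ.real (⋃ τ ∈ Bad, ev τ) :=
        (measureReal_biUnion_finset H.bad_disj (fun τ hτ => H.ev_meas τ (hBT hτ))).symm
    _ ≤ μ.real (⋃ l ∈ P, ⋃ c ∈ (Finset.univ : Finset (BlockIdx d N)), E l c) :=
        measureReal_mono hU (measure_ne_top _ _)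
    _ ≤ ∑ l ∈ P, μ.real (⋃ c ∈ (Finset.univ : Finset (BlockIdx d N)), E l c) := measureReal_biUnion_finset_le P _
    _ ≤ ∑ l ∈ P, ∑ c : BlockIdx d N, μ.real (E l c) := sum_le_sum fun l _ => measureReal_biUnion_finset_le _ _

/-- The term events' total probability is at least one (they exhaust the probability state). [folklore] -/
theorem CutoffReading.one_le_sum_ev (H : CutoffReading d N P T A Bad μ Z ev obs ob E θ mP r) :
    1 ≤ ∑ τ ∈ T, μ.real (ev τ) := by
  haveI := H.prob
  calc (1 : ℝ) = μ.real Set.univ := probReal_univ.symm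
    _ ≤ μ.real (⋃ τ ∈ T, ev τ) := measureReal_mono H.ev_cover (measure_ne_top _ _)
    _ ≤ ∑ τ ∈ T, μ.real (ev τ) := measureReal_biUnion_finset_le _ _

/-- **FILE 1's `cover` CLAUSE AT THIS CUTOFF, DERIVED** (mass currency). [folklore] -/
theorem CutoffReading.cover (H : CutoffReading d N P T A Bad μ Z ev obs ob E θ mP r) :
    ∑ τ ∈ Bad, A 0 τ ≤
      (∑ l ∈ P, ∑ c : BlockIdx d N, μ.real (⋂ c' ∈ ({c} : Finset (BlockIdx d N)), E l c')) * ∑ τ ∈ T, A 0 τ := by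
  have hBT := H.bad_subset
  have hZ := H.Z_pos
  simp only [Finset.set_biInter_singleton]
  have eBad : ∑ τ ∈ Bad, A 0 τ = Z * ∑ τ ∈ Bad, μ.real (ev τ) := by
    rw [mul_sum]; exact sum_congr rfl fun τ hτ => H.weight_zero_eq (hBT hτ)
  have eT : ∑ τ ∈ T, A 0 τ = Z * ∑ τ ∈ T, μ.real (ev τ) := by
    rw [mul_sum]; exact sum_congr rfl fun τ hτ => H.weight_zero_eq hτ
  rw [eBad, eT]
  have hX : 0 ≤ ∑ l ∈ P, ∑ c : BlockIdx d N, μ.real (E l c) :=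
    sum_nonneg fun l _ => sum_nonneg fun c _ => measureReal_nonneg
  calc Z * ∑ τ ∈ Bad, μ.real (ev τ) ≤ Z * ∑ l ∈ P, ∑ c : BlockIdx d N, μ.real (E l c) :=
        mul_le_mul_of_nonneg_left H.sum_bad_le_cells hZ.le
    _ = (∑ l ∈ P, ∑ c : BlockIdx d N, μ.real (E l c)) * (Z * 1) := by ring
    _ ≤ (∑ l ∈ P, ∑ c : BlockIdx d N, μ.real (E l c)) * (Z * ∑ τ ∈ T, μ.real (ev τ)) :=
        mul_le_mul_of_nonneg_left (mul_le_mul_of_nonneg_left H.one_le_sum_ev hZ.le) hX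

/-- **THE THREE CHESSBOARD FIELDS AT THIS CUTOFF** for the pattern functional `ψ S := μ(⋂_{c∈S} E l c)` of a pattern
`l ∈ P` — by row W5's `chessboardFields_of_isReflectionPositiveBdd` at `b c := 𝟙_{E l c}` (via `loc`, `sym`, the
RP-package fields). [folklore] -/
theorem CutoffReading.chessboardFields (H : CutoffReading d N P T A Bad μ Z ev obs ob E θ mP r) (hN : Even N) {l : Λ}
    (hl : l ∈ P) :
    (∀ S : Finset (BlockIdx d N), 0 ≤ μ.real (⋂ c ∈ S, E l c)) ∧
      μ.real (⋂ c ∈ (∅ : Finset (BlockIdx d N)), E l c) ≤ 1 ∧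
      ∀ (i : Fin d) (k : ZMod N) (S : Finset (BlockIdx d N)),
        μ.real (⋂ c ∈ S, E l c) ^ 2 ≤ μ.real (⋂ c ∈ symP i k S, E l c) * μ.real (⋂ c ∈ symM i k S, E l c) := by
  haveI := H.prob
  exact HistoryChessboardRP.chessboardFields_of_isReflectionPositiveBdd (μ := μ) mP H.mP_le θ H.θ_meas H.θ_pres
    H.θ_invol H.rp hN (fun c => (E l c).indicator (1 : Ω → ℝ))
    (fun i k c hc => (@measurable_const ℝ Ω _ (mP i k) 1).indicator (H.loc l hl i k c hc))
    (fun c ω => Set.indicator_nonneg (fun _ _ => zero_le_one) ω)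
    (fun c ω => Set.indicator_apply_le' (fun _ => le_rfl) (fun _ => zero_le_one))
    (fun i k c ω => indicator_comp_of_preimage_eq (H.sym l hl i k) c ω) (fun S => μ.real (⋂ c ∈ S, E l c))
    (fun S => measureReal_biInter_eq_integral_prod_indicator μ (H.E_meas l hl) S)
end Reading

/-! ## §3 Families of per-cutoff readings on cutoff-dependent carriers ⇒ file 1's reading ⇒ the road's END -/
section Family
variable {ι Λ : Type*} {d N : ℕ} [NeZero N] {P : Finset Λ} {T : ℕ → Finset ι} {K₀ : ℕ}
  {Ω : ℕ → Type*} [∀ K, MeasurableSpace (Ω K)] {A : ℕ → ℝ → ι → ℝ} {Bad : ℕ → Finset ι} {μ : ∀ K, Measure (Ω K)}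
  {Z : ℕ → ℝ} {ev : ∀ K, ι → Set (Ω K)} {obs : ∀ K, Ω K → ℝ} {ob : ℝ} {E : ∀ K, Λ → BlockIdx d N → Set (Ω K)}
  {θ : ∀ K, Fin d → ZMod N → Ω K → Ω K} {mP : ∀ K, Fin d → ZMod N → MeasurableSpace (Ω K)} {r : ℕ → ℝ}

/-- **FILE 1's READING FROM A FAMILY OF PER-CUTOFF READINGS ON CUTOFF-DEPENDENT CARRIERS** `Ω K`: for
`a K τ := A K 0 τ` and `ψ K l S := μ_K(⋂_{c∈S} E K l c)` — `cover` and the chessboard fields by §2 at each `K ≥ K₀`,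
`univ_le` verbatim. [folklore] -/
theorem chessboardReading_of_cutoffReadings
    (H : ∀ K, K₀ ≤ K → CutoffReading d N P (T K) (A K) (Bad K) (μ K) (Z K) (ev K) (obs K) ob (E K) (θ K) (mP K) (r K))
    (hN : Even N) :
    ChessboardReading d N P T (fun K => A K 0) Bad (fun K l S => (μ K).real (⋂ c ∈ S, E K l c)) r K₀ where
  bad_subset K hK := (H K hK).bad_subset
  nonneg K hK τ hτ := (H K hK).weight_zero_nonneg hτ
  cover K hK := (H K hK).cover
  psi_nonneg K hK l _ S := measureReal_nonneg
  psi_empty K hK l _ := by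
    haveI := (H K hK).prob
    simp
  cs K hK l hl i k S := ((H K hK).chessboardFields hN hl).2.2 i k S
  univ_le K hK := (H K hK).univ_le
  r_nonneg K hK := (H K hK).r_nonneg

/-- **THE DRESSING FAMILY** from per-cutoff readings (same source bound `ob` at every cutoff): W4's `hAd`∕`hBd` with
`m = ob·l₀`. [folklore] -/
theorem dressing_of_cutoffReadings
    (H : ∀ K, K₀ ≤ K → CutoffReading d N P (T K) (A K) (Bad K) (μ K) (Z K) (ev K) (obs K) ob (E K) (θ K) (mP K) (r K))
    {l₀ : ℝ} :
    ∀ K t, |t| ≤ l₀ → K₀ ≤ K → ∀ τ ∈ T K,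
      Real.exp (-(ob * l₀)) * A K 0 τ ≤ A K t τ ∧ A K t τ ≤ Real.exp (ob * l₀) * A K 0 τ :=
  fun K t ht hK τ hτ => (H K hK).dressing t ht τ hτ

variable [DecidableEq ι] {Ω' : ℕ → Type*} [∀ K, MeasurableSpace (Ω' K)] {B shA shB Cc Rr CcRec RrRec : ℕ → ℝ → ι → ℝ}
  {μ' : ∀ K, Measure (Ω' K)} {Z' : ℕ → ℝ} {ev' : ∀ K, ι → Set (Ω' K)} {obs' : ∀ K, Ω' K → ℝ}
  {E' : ∀ K, Λ → BlockIdx d N → Set (Ω' K)} {θ' : ∀ K, Fin d → ZMod N → Ω' K → Ω' K}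
  {mP' : ∀ K, Fin d → ZMod N → MeasurableSpace (Ω' K)} {r' ν u s₂ c₀ rr s Wsh : ℕ → ℝ} {l₀ vol : ℝ}

/-- **THE ROAD'S END FROM TWO FAMILIES OF PER-CUTOFF READINGS** (node U5, seam (ζ′)): run A read at every cutoff
`K ≥ K₀` on its carrier `Ω K`, run B on `Ω′ K` (same source bound `ob`, patterns, bad classes, threshold; rates `r`,
`r′`), `Even N`, summable rates, the NE7c socket, the NE7 budget and four summable rates give `HybridNE7` with weight
`e^{2·ob·l₀}·#P·N^d·(r + r′)` — file 1's `hybridNE7_of_chessboard`, its chessboard readings and dressing binders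
DISCHARGED by §3.  Nothing PRINTED is asserted; NE7b is NOT proved by this. [folklore] -/
theorem hybridNE7_of_cutoffReadings (hN : Even N)
    (HA : ∀ K, K₀ ≤ K → CutoffReading d N P (T K) (A K) (Bad K) (μ K) (Z K) (ev K) (obs K) ob (E K) (θ K) (mP K) (r K))
    (HB : ∀ K, K₀ ≤ K →
      CutoffReading d N P (T K) (B K) (Bad K) (μ' K) (Z' K) (ev' K) (obs' K) ob (E' K) (θ' K) (mP' K) (r' K))
    (hr : Summable r) (hr' : Summable r')
    (hSh : ShellWeightBound l₀ T A B shA shB Wsh)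
    (hTB : ReindexedBudget l₀ vol T (fun K t τ => A K t τ - shA K t τ) (fun K t τ => B K t τ - shB K t τ)
      (fun K _ => Bad K) Cc Rr CcRec RrRec ν u s₂ c₀ rr s)
    (hrr : Summable rr) (hu : Summable u) (hs : Summable s) (hs₂ : Summable s₂) :
    ∃ K₁ K₂, K₀ ≤ K₁ ∧ HybridNE7 l₀ vol (fun K => T (K₁ + (K₂ + K))) (fun K => A (K₁ + (K₂ + K)))
      (fun K => B (K₁ + (K₂ + K))) (fun K _ => Bad (K₁ + (K₂ + K)))
      (fun K => Real.exp (2 * (ob * l₀)) * ((#P : ℝ) * (N : ℝ) ^ d * (r (K₁ + (K₂ + K)) + r' (K₁ + (K₂ + K)))))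
      (fun K => shA (K₁ + (K₂ + K))) (fun K => shB (K₁ + (K₂ + K))) (fun K => Wsh (K₁ + (K₂ + K)))
      (fun K => (rr (K₁ + (K₂ + K)) + u (K₁ + (K₂ + K))) + (s (K₁ + (K₂ + K)) + s₂ (K₁ + (K₂ + K)))) :=
  hybridNE7_of_chessboard hN (chessboardReading_of_cutoffReadings HA hN) (chessboardReading_of_cutoffReadings HB hN)
    hr hr' (dressing_of_cutoffReadings HA) (dressing_of_cutoffReadings HB) hSh hTB hrr hu hs hs₂
end Family

/-! ## §4 File 2 is the constant-carrier case -/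
section Constant
variable {Ω ι Λ : Type*} [MeasurableSpace Ω] {d N : ℕ} [NeZero N] {P : Finset Λ} {T : ℕ → Finset ι}
  {A : ℕ → ℝ → ι → ℝ} {Bad : ℕ → Finset ι} {μ : ℕ → Measure Ω} {Z : ℕ → ℝ} {ev : ℕ → ι → Set Ω}
  {obs : ℕ → Ω → ℝ} {ob : ℝ} {E : ℕ → Λ → BlockIdx d N → Set Ω} {θ : ℕ → Fin d → ZMod N → Ω → Ω}
  {mP : ℕ → Fin d → ZMod N → MeasurableSpace Ω} {r : ℕ → ℝ} {K₀ : ℕ}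

/-- **FILE 2's FIXED-CARRIER READING IS A FAMILY OF PER-CUTOFF READINGS** (the constant carrier family): every
clause of `EventReading` at `K ≥ K₀` is the corresponding clause of `CutoffReading` — so file 2's END
`hybridNE7_of_events` is §3's `hybridNE7_of_cutoffReadings` on two constant families. [folklore] -/
theorem _root_.Summit.QuantumFields.BalabanUV.T4Continuum.HistoryChessboardEvents.EventReading.cutoffReading
    (H : EventReading d N P T A Bad μ Z ev obs ob E θ mP r K₀) {K : ℕ} (hK : K₀ ≤ K) :
    CutoffReading d N P (T K) (A K) (Bad K) (μ K) (Z K) (ev K) (obs K) ob (E K) (θ K) (mP K) (r K) where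
  prob := H.prob K hK
  Z_pos := H.Z_pos K hK
  bad_subset := H.bad_subset K hK
  ev_meas := H.ev_meas K hK
  E_meas := H.E_meas K hK
  obs_meas := H.obs_meas K hK
  obs_bdd := H.obs_bdd K hK
  ob_nonneg := H.ob_nonneg
  repr := H.repr K hK
  ev_cover := H.ev_cover K hK
  bad_disj := H.bad_disj K hK
  bad_sub := H.bad_sub K hK
  mP_le := H.mP_le K hK
  θ_meas := H.θ_meas K hK
  θ_pres := H.θ_pres K hK
  θ_invol := H.θ_invol K hK
  rp := H.rp K hK
  loc := H.loc K hK
  sym := H.sym K hK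
  univ_le := H.univ_le K hK
  r_nonneg := H.r_nonneg K hK
end Constant

/-! ## §5 The pull-back of an RP-package along a measure-preserving, reflection-equivariant factor map -/
section Pullback
variable {Ω Ω' : Type*} [m : MeasurableSpace Ω] {mP' : MeasurableSpace Ω'} [m' : MeasurableSpace Ω']

/-- A σ-algebra pulled back along a measurable map sits below the domain's σ-algebra. [folklore] -/
theorem comap_le_of_measurable (hm' : mP' ≤ m') {π : Ω → Ω'} (hπ : Measurable π) : mP'.comap π ≤ m :=
  (MeasurableSpace.comap_mono hm').trans hπ.comap_le

/-- **PULL-BACK OF BOUNDED REFLECTION POSITIVITY ALONG AN EQUIVARIANT FACTOR MAP**: `π : Ω → Ω′` measurable with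
`μ.map π = ν`, `θ′` measurable with `π ∘ θ = θ′ ∘ π`, `ν` reflection positive (bounded form) for `(mP′, θ′)`, `mP′ ≤ m′`
⇒ `μ` is reflection positive for `(mP′.comap π, θ)`: a bounded `mP′.comap π`-measurable observable is `h ∘ π` with `h`
bounded `mP′`-measurable (Doob–Dynkin with a bound, row W3b), and `∫ g(θω) g(ω) dμ = ∫ h(θ′y) h(y) dν ≥ 0`.  (Use: a
product carrier with `π = Prod.fst`; or one carrier for all cutoffs with `π` the cutoff's coordinate.) [folklore] -/
theorem isReflectionPositiveBdd_pullback (hm' : mP' ≤ m') {μ : Measure Ω} {ν : Measure Ω'} {π : Ω → Ω'}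
    (hπ : Measurable π) (hμν : μ.map π = ν) {θ : Ω → Ω} {θ' : Ω' → Ω'} (hθ' : Measurable θ')
    (hcomm : ∀ ω, π (θ ω) = θ' (π ω)) (hRP : IsReflectionPositiveBdd ν mP' θ') :
    IsReflectionPositiveBdd μ (mP'.comap π) θ := by
  intro g hg hgb
  obtain ⟨C, hC⟩ := hgb
  obtain ⟨h, hmeas, hbdd, hgh⟩ := HistoryRPExtension.exists_eq_comp_of_measurable_comap hg hC
  have hmeas' : Measurable[m'] h := hmeas.mono hm' le_rfl
  have hF : AEStronglyMeasurable (fun y => h (θ' y) * h y) (μ.map π) :=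
    ((hmeas'.comp hθ').mul hmeas').aestronglyMeasurable
  have key : ∫ ω, g (θ ω) * g ω ∂μ = ∫ y, h (θ' y) * h y ∂ν := by
    rw [← hμν, integral_map hπ.aemeasurable hF]
    congr 1
    funext ω
    simp only [hgh, hcomm]
  rw [key]
  exact hRP h hmeas ⟨_, hbdd⟩

/-- **THE RP-PACKAGE PULLED BACK**: with, in addition, `θ` a measurable `μ`-preserving involution of `Ω` (these three
sentences concern `Ω` itself and are hypotheses here), the five sentences `mP′.comap π ≤ m`, `Measurable θ`,
`MeasurePreserving θ μ μ`, `θ ∘ θ = id`, `IsReflectionPositiveBdd μ (mP′.comap π) θ` — the shape §1's fields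
`mP_le`∕`θ_meas`∕`θ_pres`∕`θ_invol`∕`rp` display at one block hyperplane. [folklore] -/
theorem rpPackage_pullback (hm' : mP' ≤ m') {μ : Measure Ω} {ν : Measure Ω'} {π : Ω → Ω'} (hπ : Measurable π)
    (hμν : μ.map π = ν) {θ : Ω → Ω} {θ' : Ω' → Ω'} (hθm : Measurable θ) (hθ : MeasurePreserving θ μ μ)
    (hθθ : θ ∘ θ = id) (hθ' : Measurable θ') (hcomm : ∀ ω, π (θ ω) = θ' (π ω))
    (hRP : IsReflectionPositiveBdd ν mP' θ') :
    mP'.comap π ≤ m ∧ Measurable θ ∧ MeasurePreserving θ μ μ ∧ θ ∘ θ = id ∧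
      IsReflectionPositiveBdd μ (mP'.comap π) θ :=
  ⟨comap_le_of_measurable hm' hπ, hθm, hθ, hθθ, isReflectionPositiveBdd_pullback hm' hπ hμν hθ' hcomm hRP⟩
end Pullback

/-! ## §6 Sanity: the per-cutoff reading is inhabited -/

namespace Sanity
/-- NON-VACUITY: the per-cutoff reading is INHABITED — carrier `Unit`, Dirac state, `Z = 1`, one term with event
`univ` and weight `1`, empty bad class, all cell events `univ`, source `0`, identity reflections, `mP = ⊥`, rate `1`. -/
example : CutoffReading 1 2 ({()} : Finset Unit) ({()} : Finset Unit) (fun _ _ => (1 : ℝ)) (∅ : Finset Unit)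
    (Measure.dirac ()) 1 (fun _ => Set.univ) (fun _ => 0) 0 (fun _ _ => Set.univ) (fun _ _ => id) (fun _ _ => ⊥) 1 where
  prob := Measure.dirac.isProbabilityMeasure
  Z_pos := one_pos
  bad_subset := Finset.empty_subset _
  ev_meas _ _ := MeasurableSet.univ
  E_meas _ _ _ := MeasurableSet.univ
  obs_meas := measurable_const
  obs_bdd _ := by simp
  ob_nonneg := le_rfl
  repr t τ _ := by simp [Measure.restrict_univ]
  ev_cover := fun ω _ => Set.mem_iUnion₂.2 ⟨(), Finset.mem_singleton_self _, Set.mem_univ ω⟩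
  bad_disj := by simp
  bad_sub := by simp
  mP_le _ _ := bot_le
  θ_meas _ _ := measurable_id
  θ_pres _ _ := MeasurePreserving.id _
  θ_invol _ _ := rfl
  rp _ _ := fun g _ _ => integral_nonneg fun ω => mul_self_nonneg (g ω)
  loc _ _ _ _ _ _ := by simp
  sym _ _ _ _ _ := by simp
  univ_le _ _ := (measureReal_mono (Set.subset_univ _) (measure_ne_top _ _)).trans_eq (by simp)
  r_nonneg := zero_le_one

/-- The family END accepts CUTOFF-DEPENDENT carriers: a type-check of §3's binder shape with `Ω K := Fin (K + 1) → Unit`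
(a carrier growing with `K`) — nothing is asserted (the hypothesis family is a variable). -/
example {ι Λ : Type} {P : Finset Λ} {T : ℕ → Finset ι} {A : ℕ → ℝ → ι → ℝ} {Bad : ℕ → Finset ι}
    {μ : ∀ K, Measure (Fin (K + 1) → Unit)} {Z : ℕ → ℝ} {ev : ∀ K, ι → Set (Fin (K + 1) → Unit)}
    {obs : ∀ K, (Fin (K + 1) → Unit) → ℝ} {ob : ℝ} {E : ∀ K, Λ → BlockIdx 1 2 → Set (Fin (K + 1) → Unit)}
    {θ : ∀ K, Fin 1 → ZMod 2 → (Fin (K + 1) → Unit) → (Fin (K + 1) → Unit)}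
    {mP : ∀ K, Fin 1 → ZMod 2 → MeasurableSpace (Fin (K + 1) → Unit)} {r : ℕ → ℝ} {K₀ : ℕ}
    (H : ∀ K, K₀ ≤ K → CutoffReading 1 2 P (T K) (A K) (Bad K) (μ K) (Z K) (ev K) (obs K) ob (E K) (θ K) (mP K) (r K)) :
    ChessboardReading 1 2 P T (fun K => A K 0) Bad (fun K l S => (μ K).real (⋂ c ∈ S, E K l c)) r K₀ :=
  chessboardReading_of_cutoffReadings H (by decide)
end Sanity

end

end Summit.QuantumFields.BalabanUV.T4Continuum.HistoryChessboardEventsCutoff
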